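import Summits.ResolutionOfSingularities.ResolutionOfSingularities.Theorems.FrobeniusLadderFInjectiveMacaulayficationPencilExitTagMaster
import Mathlib.RingTheory.Jacobson.Ring
import Mathlib.FieldTheory.IsAlgClosed.Basic
import Mathlib.RingTheory.MvPolynomial.Basic
import HarnessLib

/-!
# GAP-2 «k ≠ k̄» for HYPERSURFACE CHARTS: FULL at EVERY closed point (any residue field) from FULL at the rational points over an algebraically closed extension
# (crux `FInjectiveMacaulayfication` stmt-ResolutionOfSingularities-15315, chain w45a; res-L1-w45a-plan-1 RULING R23.16 (r2) «non-rational closed points: base-change to k̄ + descent —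
# stub-3»; seat res-L1-w45a-stub-3 g13; consumer: the Ω₁ local cure row ✓p702704, whose charts are FULL but SINGULAR, so the regular-chart any-field route of the class beds does not apply)

[OURS · L1 W4.5a] Support file (`--supports stmt-ResolutionOfSingularities-15315 --as helper`); theorems only; no definitions, no named facts; unconditional. Nothing of the crux is
proved; no census row is asserted. AI-written (AI review is weaker than expert review).

THE ARGUMENT (Fedder both ways; no flatness of local maps, no dimension theory). `k` any field of characteristic `p`, `K ⊇ k` algebraically closed, `Φ ∈ k[X₁..X_m]` prime, `y` a CLOSED
point of `V(Φ) = Spec k[X]/(Φ)` with `P = 𝔪_y ∩ k[X] = (a₁, …, a_{m′})` (any generators; Noetherian). By Fedder SUFFICIENCY at an arbitrary maximal ideal (✓ `hypersurface_fullCl_stalk_of_fedder`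
← `FedderAtMaximalIdeal.stub_fedderAtMaximalIdeal`) it suffices that `Φ^{p−1} ∉ (aᵢ^p)`. The residue field `k[X]/P` is algebraic over `k` (Zariski–Nullstellensatz, Mathlib
`MvPolynomial.quotient_mk_comp_C_isIntegral_of_isJacobsonRing`), so it embeds into `K` (`IsAlgClosed.lift`): a point `c ∈ K^m` with `f(c) = 0` for all `f ∈ P` (§2). If `Φ^{p−1} ∈ (aᵢ^p)`
then, mapping to `K[X]`, `Φ_K^{p−1} ∈ ((aᵢ)_K^p) ⊆ ((X_j − c_j)^p)` (each `(aᵢ)_K` vanishes at `c`, and `a ∈ (g_j) ⇒ a^p ∈ (g_j^p)` in characteristic `p`, §1) — i.e. Fedderʼs test FAILS at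
the `K`-rational point `c` of `V(Φ_K)`. But FULL at that point forces the test to PASS (Fedder NECESSITY ✓ `FedderAtMaximalIdeal.fedder_criterion_maximalIdeal`, transported
stalk ≅ `(K[X]/Φ_K)_{𝔪_c}` ≅ `K[X]_{(X−c)}/(Φ_K)`, §3). Hence FULL at every `K`-rational point of `V(Φ_K)` ⇒ FULL at every closed point of `V(Φ)` (§4).
* §1 `pow_mem_span_pow_of_mem_span`, `map_pow_mem_span_pow`; §2 `exists_geom_point_of_isMaximal`; §3 `exists_closedPoint_of_eval_eq_zero`, ★ `fedder_not_mem_of_fullCl_rational`;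
  §4 ★★ `hypersurface_fullCl_stalk_of_geom_fedder`, ★★★ `hypersurface_fullCl_closedPoint_of_rational_over_algClosed`.
[cite: Fedder1983, Prop. 1.7 and Thm. 1.12] [cite: Matsumura1987, Thm. 5.3 (Zariskiʼs lemma / Nullstellensatz)]
-/

set_option linter.dupNamespace false

noncomputable section

open AlgebraicGeometry IsLocalRing MvPolynomial
open scoped Pointwise

namespace Summit.ResolutionOfSingularities.ResolutionOfSingularities.Theorems.FInjectiveMacaulayfication.HypersurfaceFullClClosedPoints

open Summit.ResolutionOfSingularities.ResolutionOfSingularities.Theorems.FInjectiveMacaulayfication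
open SliceableCentre Literature.RingTheory.TightClosure

variable (k : Type) [Field k] (K : Type) [Field K] [Algebra k K]

/-! ## §1 Frobenius powers of generated ideals along a ring map -/

/-- In characteristic `p`: `a ∈ (g_j : j) ⇒ a^p ∈ (g_j^p : j)`. [folklore; cite: BrunsHerzog1998, §10.1] -/
theorem pow_mem_span_pow_of_mem_span (p : ℕ) [Fact p.Prime] {R : Type} [CommRing R] [CharP R p] {ι : Type} (g : ι → R) (a : R)
    (ha : a ∈ Ideal.span (Set.range g)) : a ^ p ∈ Ideal.span (Set.range fun j => g j ^ p) := by
  haveI := ExpChar.prime (R := R) (Fact.out : p.Prime)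
  have h := pow_mem_frobeniusPower (q := p ^ 1) ha
  rw [frobeniusPower_span p 1, pow_one, ← Set.range_comp] at h
  exact h

/-- `Φ^{r} ∈ (aᵢ^p)` maps to `θ(Φ)^{r} ∈ (θ(aᵢ)^p)` along any ring map `θ`. [plumbing] -/
theorem map_pow_mem_span_pow {R S : Type} [CommRing R] [CommRing S] (θ : R →+* S) (p r : ℕ) {m' : ℕ} (a : Fin m' → R) (Φ : R)
    (h : Φ ^ r ∈ Ideal.span (Set.range fun i => a i ^ p)) : θ Φ ^ r ∈ Ideal.span (Set.range fun i => θ (a i) ^ p) := by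
  have h1 := Ideal.mem_map_of_mem θ h
  rw [map_pow, Ideal.map_span, ← Set.range_comp] at h1
  refine Ideal.span_mono ?_ h1
  rintro _ ⟨i, rfl⟩
  exact ⟨i, by simp only [Function.comp, map_pow]⟩

/-! ## §2 A geometric point under every closed point (Nullstellensatz) -/

/-- **Every maximal ideal of `k[X₁..X_m]` has a `K`-point** for `K ⊇ k` algebraically closed: some `c ∈ K^m` with `f(c) = 0` for all `f ∈ P` (the residue field is algebraic over
`k`, hence embeds into `K`). [folklore; cite: Matsumura1987, Thm. 5.3] -/
theorem exists_geom_point_of_isMaximal [IsAlgClosed K] {m : ℕ} (P : Ideal (MvPolynomial (Fin m) k)) [hP : P.IsMaximal] :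
    ∃ c : Fin m → K, ∀ f ∈ P, eval c (map (algebraMap k K) f) = 0 := by
  haveI : Algebra.IsIntegral k (MvPolynomial (Fin m) k ⧸ P) := ⟨fun x => MvPolynomial.quotient_mk_comp_C_isIntegral_of_isJacobsonRing P x⟩
  letI := Ideal.Quotient.field P
  let ψ : (MvPolynomial (Fin m) k ⧸ P) →ₐ[k] K := IsAlgClosed.lift
  refine ⟨fun j => ψ (Ideal.Quotient.mk P (X j)), fun f hf => ?_⟩
  have key : ∀ g : MvPolynomial (Fin m) k, eval (fun j => ψ (Ideal.Quotient.mk P (X j))) (map (algebraMap k K) g) = ψ (Ideal.Quotient.mk P g) := by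
    intro g
    rw [eval_map, ← aeval_def]
    change aeval _ g = (ψ.comp (Ideal.Quotient.mkₐ k P)) g
    congr 1
    refine MvPolynomial.algHom_ext fun j => ?_
    rw [aeval_X, AlgHom.comp_apply, Ideal.Quotient.mkₐ_eq_mk]
  rw [key, Ideal.Quotient.eq_zero_iff_mem.2 hf, map_zero]

/-! ## §3 Fedder necessity at a rational point of a hypersurface -/

/-- **The closed point of `V(Ψ)` with coordinates `c`** (`Ψ(c) = 0`): a maximal ideal of `K[X]/(Ψ)` contracting to `(X_j − c_j : j)`. [plumbing] -/
theorem exists_closedPoint_of_eval_eq_zero {m : ℕ} (Ψ : MvPolynomial (Fin m) K) (c : Fin m → K) (hc : eval c Ψ = 0) :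
    ∃ y : Spec (.of (MvPolynomial (Fin m) K ⧸ Ideal.span {Ψ})), y.asIdeal.IsMaximal ∧
      y.asIdeal.comap (Ideal.Quotient.mk (Ideal.span {Ψ})) = Ideal.span (Set.range fun j : Fin m => (X j : MvPolynomial (Fin m) K) - C (c j)) := by
  set 𝔪 : Ideal (MvPolynomial (Fin m) K) := Ideal.span (Set.range fun j : Fin m => (X j : MvPolynomial (Fin m) K) - C (c j)) with h𝔪
  have hΨmem : Ψ ∈ 𝔪 := PencilExitTagMaster.mem_span_of_eval_eq_zero K c Ψ hc
  have hker : Ideal.span {Ψ} ≤ 𝔪 := (Ideal.span_singleton_le_iff_mem _).2 hΨmem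
  have h𝔪max : 𝔪.IsMaximal := by
    have hle : 𝔪 ≤ RingHom.ker (eval c) := by
      rw [h𝔪, Ideal.span_le]; rintro _ ⟨j, rfl⟩
      rw [SetLike.mem_coe, RingHom.mem_ker, map_sub, eval_X, eval_C, sub_self]
    have hge : RingHom.ker (eval c) ≤ 𝔪 := fun f hf => PencilExitTagMaster.mem_span_of_eval_eq_zero K c f hf
    rw [le_antisymm hle hge]
    exact RingHom.ker_isMaximal_of_surjective _ fun x => ⟨C x, eval_C x⟩
  have hne_top : (𝔪.map (Ideal.Quotient.mk (Ideal.span {Ψ}))) ≠ ⊤ := by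
    intro htop
    have := Ideal.comap_map_of_surjective (Ideal.Quotient.mk (Ideal.span {Ψ})) Ideal.Quotient.mk_surjective 𝔪
    rw [htop, Ideal.comap_top] at this
    have h2 : 𝔪 ⊔ Ideal.comap (Ideal.Quotient.mk (Ideal.span {Ψ})) ⊥ = 𝔪 := by
      rw [sup_eq_left, ← RingHom.ker_eq_comap_bot, Ideal.mk_ker]; exact hker
    rw [h2] at this
    exact h𝔪max.ne_top this.symm
  have hmax' : (𝔪.map (Ideal.Quotient.mk (Ideal.span {Ψ}))).IsMaximal := by
    refine ⟨⟨hne_top, fun J hJ => ?_⟩⟩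
    have h1 : 𝔪 < J.comap (Ideal.Quotient.mk (Ideal.span {Ψ})) := by
      refine lt_of_le_of_ne (fun f hf => ?_) (fun heq => ?_)
      · exact Ideal.mem_comap.2 (hJ.le (Ideal.mem_map_of_mem _ hf))
      · apply hJ.ne
        rw [heq, Ideal.map_comap_of_surjective _ Ideal.Quotient.mk_surjective]
    have h2 := h𝔪max.1.2 _ h1
    rw [Ideal.comap_eq_top_iff] at h2
    exact h2
  refine ⟨⟨𝔪.map (Ideal.Quotient.mk (Ideal.span {Ψ})), hmax'.isPrime⟩, hmax', ?_⟩
  change (𝔪.map (Ideal.Quotient.mk (Ideal.span {Ψ}))).comap _ = _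
  rw [Ideal.comap_map_of_surjective _ Ideal.Quotient.mk_surjective, ← RingHom.ker_eq_comap_bot, Ideal.mk_ker, sup_eq_left.2 hker]

/-- ★ **FEDDER NECESSITY AT A RATIONAL POINT, scheme vocabulary**: if the hypersurface `V(Ψ) ⊂ 𝔸^m_K` (`Ψ ≠ 0`, `char K = p`) is `FullCl p` at its closed point `(c)`, then
`Ψ^{p−1} ∉ ((X_j − c_j)^p : j)`. (✓ `fedder_criterion_maximalIdeal` at `P = (X_j − c_j)`, transported along stalk ≅ `(K[X]/Ψ)_{𝔪}` ≅ `K[X]_P/(Ψ)`.) [cite: Fedder1983, Prop. 1.7 and Thm. 1.12] -/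
theorem fedder_not_mem_of_fullCl_rational (p : ℕ) [Fact p.Prime] [CharP K p] {m : ℕ} (Ψ : MvPolynomial (Fin m) K) (hΨ0 : Ψ ≠ 0) (c : Fin m → K)
    (y : Spec (.of (MvPolynomial (Fin m) K ⧸ Ideal.span {Ψ}))) (hy : y.asIdeal.IsMaximal)
    (ha : y.asIdeal.comap (Ideal.Quotient.mk (Ideal.span {Ψ})) = Ideal.span (Set.range fun j : Fin m => (X j : MvPolynomial (Fin m) K) - C (c j)))
    (hfull : FullCl p ((Spec (.of (MvPolynomial (Fin m) K ⧸ Ideal.span {Ψ}))).presheaf.stalk y)) :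
    Ψ ^ (p - 1) ∉ Ideal.span (Set.range fun j : Fin m => ((X j : MvPolynomial (Fin m) K) - C (c j)) ^ p) := by
  haveI := hy
  haveI hPmax : (y.asIdeal.comap (Ideal.Quotient.mk (Ideal.span {Ψ}))).IsMaximal := Ideal.comap_isMaximal_of_surjective _ Ideal.Quotient.mk_surjective
  have hΨP : Ψ ∈ y.asIdeal.comap (Ideal.Quotient.mk (Ideal.span {Ψ})) := by
    rw [Ideal.mem_comap, Ideal.Quotient.eq_zero_iff_mem.mpr (Ideal.mem_span_singleton_self Ψ)]
    exact y.asIdeal.zero_mem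
  -- FULL on the stalk ⇒ the clause on `(K[X]/Ψ)_𝔪` ⇒ on `K[X]_P/(Ψ)`
  have hloc : FullCl p (Localization.AtPrime y.asIdeal) := WFixAtNonClosedDimTwo.fullCl_of_ringEquiv p (Spec.stalkIso (.of _) y).commRingCatIsoToRingEquiv hfull
  obtain ⟨e₁⟩ := QuotLocalizationIso.stub_quotLocalizationIso (MvPolynomial (Fin m) K) Ψ (y.asIdeal.comap (Ideal.Quotient.mk (Ideal.span {Ψ}))) y.asIdeal rfl
  have hup := DegreeZeroDescent.inlineClause_of_ringEquiv p e₁.symm hloc.2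
  exact (FedderAtMaximalIdeal.fedder_criterion_maximalIdeal K m m p (y.asIdeal.comap (Ideal.Quotient.mk (Ideal.span {Ψ}))) _ ha Ψ hΨP hΨ0).mp hup

/-! ## §4 ★★ FULL at every closed point -/

/-- ★★ **FULL AT EVERY CLOSED POINT FROM THE GEOMETRIC FEDDER TEST**: `Φ ∈ k[X₁..X_m]` prime, `K ⊇ k` algebraically closed; if Fedderʼs test `Φ_K^{p−1} ∉ ((X_j − c_j)^p)` passes at every
`K`-point `c` of `V(Φ_K)`, then `V(Φ)` is `FullCl p` at EVERY closed point (whatever its residue field). [OURS · GAP-2 engine for hypersurface charts; cite: Fedder1983, Thm. 1.12] -/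
theorem hypersurface_fullCl_stalk_of_geom_fedder (p : ℕ) [Fact p.Prime] [CharP k p] [IsAlgClosed K] {m : ℕ} (Φ : MvPolynomial (Fin m) k) (hΦ : Prime Φ)
    (hK : ∀ c : Fin m → K, eval c (map (algebraMap k K) Φ) = 0 →
      (map (algebraMap k K) Φ) ^ (p - 1) ∉ Ideal.span (Set.range fun j : Fin m => ((X j : MvPolynomial (Fin m) K) - C (c j)) ^ p))
    (y : Spec (.of (MvPolynomial (Fin m) k ⧸ Ideal.span {Φ}))) (hy : y.asIdeal.IsMaximal) :
    FullCl p ((Spec (.of (MvPolynomial (Fin m) k ⧸ Ideal.span {Φ}))).presheaf.stalk y) := by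
  haveI := hy
  haveI : CharP K p := charP_of_injective_algebraMap (algebraMap k K).injective p
  set P := y.asIdeal.comap (Ideal.Quotient.mk (Ideal.span {Φ})) with hPdef
  haveI hPmax : P.IsMaximal := Ideal.comap_isMaximal_of_surjective _ Ideal.Quotient.mk_surjective
  have hΦP : Φ ∈ P := by
    rw [hPdef, Ideal.mem_comap, Ideal.Quotient.eq_zero_iff_mem.mpr (Ideal.mem_span_singleton_self Φ)]
    exact y.asIdeal.zero_mem
  -- finitely many generators of `P`
  obtain ⟨m', a, ha⟩ := Submodule.fg_iff_exists_fin_generating_family.1 (IsNoetherian.noetherian P)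
  have ha' : P = Ideal.span (Set.range a) := ha.symm
  refine PencilExitSoundnessKit.hypersurface_fullCl_stalk_of_fedder k p Φ hΦ a y hy ha' fun hfed => ?_
  -- a geometric point under `P`
  obtain ⟨c, hc⟩ := exists_geom_point_of_isMaximal k K P
  refine hK c (hc Φ hΦP) ?_
  have h1 := map_pow_mem_span_pow (map (algebraMap k K)) p (p - 1) a Φ hfed
  refine (Ideal.span_le.2 ?_) h1
  rintro _ ⟨i, rfl⟩
  exact pow_mem_span_pow_of_mem_span p _ _ (PencilExitTagMaster.mem_span_of_eval_eq_zero K c _ (hc (a i) (ha' ▸ Ideal.subset_span ⟨i, rfl⟩)))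

/-- ★★★ **FULL AT EVERY CLOSED POINT FROM FULL AT THE RATIONAL POINTS OVER AN ALGEBRAICALLY CLOSED EXTENSION**: `Φ ∈ k[X₁..X_m]` prime, `K ⊇ k` algebraically closed of
characteristic `p`, `Ψ = Φ_K`; if `V(Ψ)` is `FullCl p` at every closed point with coordinates in `K`, then `V(Φ)` is `FullCl p` at EVERY closed point. (The form the Ω₁ row consumes: its
theorems hold over every field, in particular over `K = k̄`.) [OURS · GAP-2 engine; cite: Fedder1983, Prop. 1.7 and Thm. 1.12] -/
theorem hypersurface_fullCl_closedPoint_of_rational_over_algClosed (p : ℕ) [Fact p.Prime] [CharP k p] [IsAlgClosed K] {m : ℕ}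
    (Φ : MvPolynomial (Fin m) k) (hΦ : Prime Φ) (Ψ : MvPolynomial (Fin m) K) (hΨ : map (algebraMap k K) Φ = Ψ)
    (hrow : ∀ (c : Fin m → K) (y' : Spec (.of (MvPolynomial (Fin m) K ⧸ Ideal.span {Ψ}))), y'.asIdeal.IsMaximal →
      y'.asIdeal.comap (Ideal.Quotient.mk (Ideal.span {Ψ})) = Ideal.span (Set.range fun j : Fin m => (X j : MvPolynomial (Fin m) K) - C (c j)) →
      FullCl p ((Spec (.of (MvPolynomial (Fin m) K ⧸ Ideal.span {Ψ}))).presheaf.stalk y'))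
    (y : Spec (.of (MvPolynomial (Fin m) k ⧸ Ideal.span {Φ}))) (hy : y.asIdeal.IsMaximal) :
    FullCl p ((Spec (.of (MvPolynomial (Fin m) k ⧸ Ideal.span {Φ}))).presheaf.stalk y) := by
  haveI : CharP K p := charP_of_injective_algebraMap (algebraMap k K).injective p
  refine hypersurface_fullCl_stalk_of_geom_fedder k K p Φ hΦ (fun c hc => ?_) y hy
  rw [hΨ] at hc ⊢
  have hΨ0 : Ψ ≠ 0 := by
    rw [← hΨ]; exact fun h => hΦ.ne_zero (map_injective _ (algebraMap k K).injective (by rw [h, map_zero]))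
  obtain ⟨y', hy', ha'⟩ := exists_closedPoint_of_eval_eq_zero K Ψ c hc
  exact fedder_not_mem_of_fullCl_rational K p Ψ hΨ0 c y' hy' ha' (hrow c y' hy' ha')

end Summit.ResolutionOfSingularities.ResolutionOfSingularities.Theorems.FInjectiveMacaulayfication.HypersurfaceFullClClosedPoints

end
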